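import Literature.MathematicalPhysics.QuantumFieldTheory.Balaban1983to89.B13FamilySum

/-!
# BalabanUVNodes ∕ node N20 (NE7b) — THE (V‑a) BINDER FROM AN ABSTRACT REFRESH PROCESS, FILE 1 of 2: the over-age large deviation of idea-3's hellinger road
# (memo `OVERAGE-RATE-READING-idea3-g13.md` §3(d)–(e); kernel `Cruxes/…/RefreshProcessSketch.lean` §14) re-proved `def`-free under `Theorems/`, IMPORTABLE

Cell `pub-ymgap` (HUMAN RULING D-0062 Track A ∕ director-ym R399 (3a) second-wave width seats), WIDTH SEAT `pub-ymgap-dag-n20-w5` (node n20 = NE7b),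
generation g4, CLAIM-1 ∕ INTENT-1 (bus 2026-08-28T09:11:40Z; 400-line split: FILE 1 = THIS FILE, the process arithmetic; FILE 2 = `…N20OverAgeRefreshProcessAtClassWeights`,
the junction BY NAME with dag-n19-w4's p618979 `affinityDefectLetter_of_tameTilts` + toys).  Key item K3⁷ `SpineGivenEndpointR13SepCoPH` (stmt-QuantumFields-20544;
skeleton of record v5 941dddb108cbaacf, stub 2 `stub_expansion13H`); filed `--kind proof --supports … --as helper`.  COUNT-NEUTRAL.  THEOREMS ONLY (0 `def`,
0 `instance`, 0 `notation`, 0 `sorry`).  ADDITIVE — imports the tree's `Balaban1983to89.B13FamilySum` ONLY (`prod_one_add_le_exp_sum` BY NAME; Mathlib through it).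

WHY.  The K-summation of record of idea-3's road (card `Ideas/hellinger-free-energy-road.md` EDITION 5; importable twin p618979 `hellingerRate_of_tameTilts` ∕
`affinityDefectLetter_of_tameTilts`, dag-n19-w4 g6) consumes the two runs' ONE-RUN over-aged («wild») class masses through the binders
`(wm : ℕ → ℝ) (hwm : ∀ K, 0 ≤ wm K) (hwildA hwildB : … ≤ wm K) (hws : Summable fun K => √(wm K))` — letter (V‑a).  Edition 4 of the card READ (V‑a) off print
([LF‑II] (1.79)–(1.85), pp.380–386) as a DERIVED-ON-PAPER one-run large deviation; idea-3 g14's `Cruxes/…/RefreshProcessSketch.lean` (§14, crux write 2026-08-28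
09:08Z) kernel-checks its ARITHMETIC over an abstract refresh process — but `Cruxes/` material is importable by nothing and carries a `def`.  THIS FILE is the
importable `def`-free twin (the PATTERN SUM `Σ_{S ⊆ U, Δ ≤ Σ_S ℓ} Π_{j∈S} w j` is spelled out at every occurrence):
* §1 [folklore] ★ `patternSum_le_exp_mul_prod` — CHERNOFF OVER REFRESH PATTERNS `≤ e^{−θΔ}·Π_{j∈U}(1 + w j·e^{θ ℓ j})` (`Finset.prod_one_add`); ★ `patternSum_le_of_priceLetters` —
  with `w ≤ e^{−P}`, rate `θ·ℓ ≤ P∕2`, entropy `Σ_U e^{−P∕2} ≤ Z`: `≤ e^{−θΔ}·e^{Z}` (`Π(1+z) ≤ e^{Σz}` = the tree's `B13FamilySum.prod_one_add_le_exp_sum` BY NAME).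
* §2 [folklore] GEOMETRIC TAIL beyond a threshold, finite sums only (no `tsum`, no junk values): `sum_indicator_geom_le`, `sum_indicator_exp_le` (real threshold).
* §3 [folklore] RATE ⇒ SUMMABILITY: `summable_sqrt_of_le_exp_log` (`w K ≤ C·e^{−a log K}`, `a > 2` ⇒ `Σ√w < ∞` — the road's (V‑a), exponent 2);
  `summable_of_le_exp_log` (`a > 1`, `w ≥ 0` ⇒ `Σ w < ∞` — `window-key-core`'s booked-mass letter (AC), exponent 1).
* §4 ASSEMBLY: ★★ `wildMass_rate_of_refreshProcess` (ONE `(K,t)`: the letters + the MODELLING letter `hmodel` — the wild mass is at most `C₀` × any upper bound of the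
  partial sums of `Σ_m 𝟙[x ≤ m] e^{Λm}·patternSum_m(m − b)` ⇒ `wild ≤ C₀·e^{Z₀+θb}·e^{−(θ−Λ−ζ)x}∕(1 − e^{−(θ−Λ−ζ)})`); ★★ `wildMass_rateAlongK_of_refreshProcess`
  (threshold `x_K = b + κ₁ log K` ⇒ rate `C·e^{−κ₁(θ−Λ−ζ) log K}` for `K ≥ 1`); ★★★ `wildMass_summable_of_refreshProcess` (`κ₁(θ − Λ − ζ) > 2` ⇒
  `∃ wm ≥ 0, Summable √wm, wild K t ≤ wm K` — the (V‑a) binder list); `wildMass_summableOne_of_refreshProcess` (`> 1` ⇒ `Summable wm`); `wildMass_summable_pair`.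
CREDIT.  The refresh process, its dictionary to [LF‑II] and the chain §14.1–§14.6: idea-3 g13–g14 (`YMNodeOIdeate.Idea3.HellingerRoad.RefreshProcess.*`, re-lettered,
not imported — `Cruxes/` is not importable); the re-price of the reading (located A∧B, derived-not-quoted): CRIT-1 g6 (`CRIT-1-REPRICE-hellinger-free-energy-road-ed5-overage.md`).
LOCATED PRIOR KERNEL (dag-n20-w4 g3, bus 09:18Z — it types the SAME `wm` socket from the tree's persistent-history count): §1 is the `θ`-tilted, real-threshold twin of
`T4PersistentHistoryCount.pairedRecordSum_le` ∕ `slotPrice_le` ∕ `oldSlotBudget_le`; new here: the abstract letters of idea-3's process (`hmodel`, `ζ`) and EXPONENT 2.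

HONEST FRAMING.  [folklore] finite combinatorics and real analysis on HYPOTHESIS SHAPES.  EVERY letter — event sets `U`, factors `w`, prices `P`, epoch lengths `ℓ`,
the rate `θ`, the entropy bound `Z₀ + ζ m`, the budget `b`, the block entropy `Λ`, the constant `C₀`, and above all the MODELLING inequality `hmodel` (over-aged
one-run class mass ≤ `C₀ · Σ_m e^{Λm}·patternSum`) — is a hypothesis produced by nobody; their truth for Bałaban's kernels is idea-3 g13's READING of [LF‑II]
(1.79)–(1.85) (derived on paper; three OCR spots flagged in the memo), NOT asserted here and NOT kernel-checked.  What moves from «derived on paper» to «kernel-checked,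
importable» is the ARITHMETIC of the memo's §3(d)–(e) — nothing else.  NO estimate of Bałaban's programme is proved; nothing of Bałaban's asserted or instantiated
(no `Provisos₁₃CoPH` tuple — K0⁷ OPEN); (V‑b) = (YG), (KR), (R′), (R‑c) untouched and UNPRINTED for d = 4; NE7 ∕ NE7b ∕ NE7c NOT PRINTED as two-run statements for
d = 4 and NOT proved; N19 ∕ N20 ∕ N21 NOT discharged; K3⁷ OPEN, v5 STANDS, not claimed; no summit statement is proved by this seat; counts UNMOVED (typed 28∕28 ·
discharged 5∕27, A 5∕28).  One finite four-torus programme at fixed ε — NOT ℝ⁴, NOT infinite volume, NOT OS, NOT a mass gap, NOT the Clay problem (R4 closes the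
conditional finite-𝕋⁴ rung `BalabanLadder.UV` only).  0 `def`; 0 `sorry`; standard axioms; no cite tags.
-/

noncomputable section

namespace Summit.QuantumFields.YangMills.BalabanUVNodes.N20OverAgeRefreshProcess

open Finset
open Literature.MathematicalPhysics.QuantumFieldTheory.Balaban1983to89.B13FamilySum (prod_one_add_le_exp_sum)
variable {α : Type*}
/-! ## §1 Chernoff bound over refresh patterns, and the price letters [folklore] -/

section Patterns

/-- **★ CHERNOFF OVER REFRESH PATTERNS** [folklore].  For `θ ≥ 0` and nonnegative factors,
`Σ_{S ⊆ U, Δ ≤ Σ_S ℓ} Π_{j∈S} w j ≤ e^{−θΔ} · Π_{j∈U} (1 + w j · e^{θ ℓ j})`: the covering indicator is `≤ e^{θ(Σ_S ℓ − Δ)}`, then the constraint is dropped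
and `Σ_{S ⊆ U} Π_S f = Π_U (1 + f)` (`Finset.prod_one_add`). -/
theorem patternSum_le_exp_mul_prod (U : Finset α) (w ℓ : α → ℝ) (hw : ∀ j ∈ U, 0 ≤ w j) {θ : ℝ} (hθ : 0 ≤ θ) (Δ : ℝ) :
    ∑ S ∈ U.powerset with Δ ≤ ∑ j ∈ S, ℓ j, ∏ j ∈ S, w j
      ≤ Real.exp (-(θ * Δ)) * ∏ j ∈ U, (1 + w j * Real.exp (θ * ℓ j)) := by
  have key : ∀ S ∈ U.powerset.filter (fun S => Δ ≤ ∑ j ∈ S, ℓ j),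
      ∏ j ∈ S, w j ≤ Real.exp (-(θ * Δ)) * ∏ j ∈ S, (w j * Real.exp (θ * ℓ j)) := by
    intro S hS
    rw [mem_filter, mem_powerset] at hS
    obtain ⟨hSU, hΔ⟩ := hS
    have hP : 0 ≤ ∏ j ∈ S, w j := prod_nonneg fun j hj => hw j (hSU hj)
    have hprod : 0 ≤ θ * ((∑ j ∈ S, ℓ j) - Δ) := mul_nonneg hθ (sub_nonneg.2 hΔ)
    have h1 : 1 ≤ Real.exp (-(θ * Δ)) * Real.exp (θ * ∑ j ∈ S, ℓ j) := by
      rw [← Real.exp_add]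
      exact Real.one_le_exp (by nlinarith [hprod])
    have e : ∏ j ∈ S, (w j * Real.exp (θ * ℓ j)) = (∏ j ∈ S, w j) * Real.exp (θ * ∑ j ∈ S, ℓ j) := by
      rw [prod_mul_distrib, mul_sum, Real.exp_sum]
    rw [e]
    calc ∏ j ∈ S, w j = (∏ j ∈ S, w j) * 1 := (mul_one _).symm
      _ ≤ (∏ j ∈ S, w j) * (Real.exp (-(θ * Δ)) * Real.exp (θ * ∑ j ∈ S, ℓ j)) :=
          mul_le_mul_of_nonneg_left h1 hP
      _ = Real.exp (-(θ * Δ)) * ((∏ j ∈ S, w j) * Real.exp (θ * ∑ j ∈ S, ℓ j)) := by ring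
  calc ∑ S ∈ U.powerset with Δ ≤ ∑ j ∈ S, ℓ j, ∏ j ∈ S, w j
      ≤ ∑ S ∈ U.powerset with Δ ≤ ∑ j ∈ S, ℓ j, Real.exp (-(θ * Δ)) * ∏ j ∈ S, (w j * Real.exp (θ * ℓ j)) :=
        sum_le_sum key
    _ ≤ ∑ S ∈ U.powerset, Real.exp (-(θ * Δ)) * ∏ j ∈ S, (w j * Real.exp (θ * ℓ j)) := by
        refine sum_le_sum_of_subset_of_nonneg (filter_subset _ _) fun S hS _ => ?_
        exact mul_nonneg (Real.exp_nonneg _)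
          (prod_nonneg fun j hj => mul_nonneg (hw j (mem_powerset.1 hS hj)) (Real.exp_nonneg _))
    _ = Real.exp (-(θ * Δ)) * ∏ j ∈ U, (1 + w j * Real.exp (θ * ℓ j)) := by
        rw [← mul_sum, prod_one_add]

/-- **★ THE PATTERN SUM UNDER THE PRICE LETTERS** [folklore].  With factors `0 ≤ w j ≤ e^{−P j}`, the RATE letter `θ·ℓ j ≤ P j ∕ 2` (`θ ≥ 0`) and the ENTROPY letter
`Σ_{j∈U} e^{−P j∕2} ≤ Z`: `Σ_{S ⊆ U, Δ ≤ Σ_S ℓ} Π_S w ≤ e^{−θΔ}·e^{Z}` (each tilted factor `w j·e^{θ ℓ j} ≤ e^{−P j∕2}`, then `Π(1+z) ≤ e^{Σz}` — the tree's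
`B13FamilySum.prod_one_add_le_exp_sum` BY NAME). -/
theorem patternSum_le_of_priceLetters (U : Finset α) {w ℓ P : α → ℝ} (hw0 : ∀ j ∈ U, 0 ≤ w j)
    (hw : ∀ j ∈ U, w j ≤ Real.exp (-P j)) {θ : ℝ} (hθ : 0 ≤ θ) (hθP : ∀ j ∈ U, θ * ℓ j ≤ P j / 2)
    {Z : ℝ} (hZ : ∑ j ∈ U, Real.exp (-(P j / 2)) ≤ Z) (Δ : ℝ) :
    ∑ S ∈ U.powerset with Δ ≤ ∑ j ∈ S, ℓ j, ∏ j ∈ S, w j ≤ Real.exp (-(θ * Δ)) * Real.exp Z := by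
  refine (patternSum_le_exp_mul_prod U w ℓ hw0 hθ Δ).trans (mul_le_mul_of_nonneg_left ?_ (Real.exp_nonneg _))
  have hz : ∀ j ∈ U, w j * Real.exp (θ * ℓ j) ≤ Real.exp (-(P j / 2)) := fun j hj => by
    calc w j * Real.exp (θ * ℓ j) ≤ Real.exp (-P j) * Real.exp (θ * ℓ j) :=
          mul_le_mul_of_nonneg_right (hw j hj) (Real.exp_nonneg _)
      _ = Real.exp (-P j + θ * ℓ j) := (Real.exp_add _ _).symm
      _ ≤ Real.exp (-(P j / 2)) := Real.exp_le_exp.2 (by linarith [hθP j hj])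
  calc ∏ j ∈ U, (1 + w j * Real.exp (θ * ℓ j)) ≤ ∏ j ∈ U, (1 + Real.exp (-(P j / 2))) :=
        prod_le_prod (fun j hj => add_nonneg zero_le_one (mul_nonneg (hw0 j hj) (Real.exp_nonneg _)))
          fun j hj => by linarith [hz j hj]
    _ ≤ Real.exp (∑ j ∈ U, Real.exp (-(P j / 2))) := prod_one_add_le_exp_sum U _ fun j _ => Real.exp_nonneg _
    _ ≤ Real.exp Z := Real.exp_le_exp.2 hZ

end Patterns

/-! ## §2 The geometric tail over birth depths beyond a threshold — finite sums only, no `tsum`, no junk values [folklore] -/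

section Tails

/-- [folklore] `Σ_{m<M} 𝟙[N ≤ m]·q^m ≤ q^N ∕ (1 − q)` for `0 ≤ q < 1` and every `M` (telescoping: the partial sum times `1 − q` is `q^N − q^{max(N,M)}`). -/
theorem sum_indicator_geom_le {q : ℝ} (hq0 : 0 ≤ q) (hq1 : q < 1) (N M : ℕ) :
    ∑ m ∈ range M, (if N ≤ m then q ^ m else 0) ≤ q ^ N / (1 - q) := by
  have h1q : 0 < 1 - q := sub_pos.2 hq1
  have inv : ∀ M : ℕ, (∑ m ∈ range M, (if N ≤ m then q ^ m else 0)) * (1 - q)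
      ≤ q ^ N - (if N ≤ M then q ^ M else q ^ N) := by
    intro M
    induction M with
    | zero =>
      rw [range_zero, sum_empty, zero_mul]
      split_ifs with h
      · rw [Nat.le_zero.1 h, sub_self]
      · rw [sub_self]
    | succ M ih =>
      rw [sum_range_succ, add_mul]
      by_cases hNM : N ≤ M
      · have hNM1 : N ≤ M + 1 := Nat.le_succ_of_le hNM
        rw [if_pos hNM, if_pos hNM1]
        rw [if_pos hNM] at ih
        have e1 : q ^ M * (1 - q) = q ^ M - q ^ (M + 1) := by ring
        linarith
      · rw [if_neg hNM, zero_mul, add_zero]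
        rw [if_neg hNM] at ih
        by_cases hNM1 : N ≤ M + 1
        · have hN : N = M + 1 := le_antisymm hNM1 (Nat.succ_le_of_lt (not_le.1 hNM))
          rw [if_pos hNM1, ← hN]
          linarith
        · rw [if_neg hNM1]
          linarith
  have hM := inv M
  have hsub : 0 ≤ (if N ≤ M then q ^ M else q ^ N) := by split_ifs <;> positivity
  rw [le_div_iff₀ h1q]
  linarith

/-- [folklore] REAL THRESHOLD, EXPONENTIAL FORM: for `r > 0`, any real `x` and every `M`, `Σ_{m<M} 𝟙[x ≤ m]·e^{−r m} ≤ e^{−r x} ∕ (1 − e^{−r})`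
(through the integer threshold `⌈x⌉₊` and `sum_indicator_geom_le` with `q = e^{−r}`). -/
theorem sum_indicator_exp_le {r : ℝ} (hr : 0 < r) (x : ℝ) (M : ℕ) :
    ∑ m ∈ range M, (if x ≤ (m : ℝ) then Real.exp (-(r * m)) else 0)
      ≤ Real.exp (-(r * x)) / (1 - Real.exp (-r)) := by
  set q : ℝ := Real.exp (-r) with hq
  have hq0 : 0 ≤ q := Real.exp_nonneg _
  have hq1 : q < 1 := Real.exp_lt_one_iff.2 (by linarith)
  have h1q : 0 < 1 - q := sub_pos.2 hq1
  have hterm : ∀ m : ℕ, (if x ≤ (m : ℝ) then Real.exp (-(r * m)) else 0)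
      ≤ (if ⌈x⌉₊ ≤ m then q ^ m else 0) := by
    intro m
    by_cases hxm : x ≤ (m : ℝ)
    · rw [if_pos hxm, if_pos (Nat.ceil_le.2 hxm)]
      have e : Real.exp (-(r * m)) = q ^ m := by
        rw [hq, ← Real.exp_nat_mul]; congr 1; ring
      rw [e]
    · rw [if_neg hxm]
      split_ifs <;> positivity
  have hN : q ^ ⌈x⌉₊ ≤ Real.exp (-(r * x)) := by
    have e : q ^ ⌈x⌉₊ = Real.exp (-(r * ⌈x⌉₊)) := by
      rw [hq, ← Real.exp_nat_mul]; congr 1; ring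
    rw [e]
    exact Real.exp_le_exp.2 (by nlinarith [Nat.le_ceil x])
  calc ∑ m ∈ range M, (if x ≤ (m : ℝ) then Real.exp (-(r * m)) else 0)
      ≤ ∑ m ∈ range M, (if ⌈x⌉₊ ≤ m then q ^ m else 0) := sum_le_sum fun m _ => hterm m
    _ ≤ q ^ ⌈x⌉₊ / (1 - q) := sum_indicator_geom_le hq0 hq1 _ _
    _ ≤ Real.exp (-(r * x)) / (1 - q) := by
        rw [div_eq_mul_inv, div_eq_mul_inv]
        exact mul_le_mul_of_nonneg_right hN (inv_nonneg.2 h1q.le)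

end Tails

/-! ## §3 Rate ⇒ summability [folklore: `p`-series] -/

section Rates

/-- [folklore] EXPONENT 2 (the road's (V‑a)): if `w K ≤ C·e^{−a·log K}` for `K ≥ 1` with `C ≥ 0`, `a > 2`, then `Σ_K √(w K) < ∞`
(`√(w K) ≤ √C·K^{−a∕2}` and `Real.summable_nat_rpow`; `√` of a negative is `0`, so no sign hypothesis on `w` is needed). -/
theorem summable_sqrt_of_le_exp_log {C a : ℝ} (hC : 0 ≤ C) (ha : 2 < a) (w : ℕ → ℝ)
    (hw : ∀ K : ℕ, 1 ≤ K → w K ≤ C * Real.exp (-(a * Real.log K))) :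
    Summable (fun K => Real.sqrt (w K)) := by
  have hs : Summable (fun K : ℕ => Real.sqrt C * ((K : ℝ) ^ (-(a / 2)))) :=
    (Real.summable_nat_rpow.2 (by linarith)).mul_left _
  have hs1 : Summable (fun K : ℕ => Real.sqrt C * (((K + 1 : ℕ) : ℝ) ^ (-(a / 2)))) :=
    (summable_nat_add_iff 1).2 hs
  refine (summable_nat_add_iff 1).1 (Summable.of_nonneg_of_le (fun K => Real.sqrt_nonneg _) (fun K => ?_) hs1)
  show Real.sqrt (w (K + 1)) ≤ Real.sqrt C * (((K + 1 : ℕ) : ℝ) ^ (-(a / 2)))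
  have hKpos : (0 : ℝ) < ((K + 1 : ℕ) : ℝ) := by positivity
  have h := hw (K + 1) (Nat.succ_le_succ (Nat.zero_le K))
  have e : Real.exp (-(a * Real.log ((K + 1 : ℕ) : ℝ))) = ((((K + 1 : ℕ) : ℝ)) ^ (-(a / 2))) ^ 2 := by
    rw [← Real.rpow_natCast, ← Real.rpow_mul hKpos.le, Real.rpow_def_of_pos hKpos]
    congr 1
    push_cast
    ring
  calc Real.sqrt (w (K + 1)) ≤ Real.sqrt (C * ((((K + 1 : ℕ) : ℝ)) ^ (-(a / 2))) ^ 2) :=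
        Real.sqrt_le_sqrt (by rw [← e]; exact h)
    _ = Real.sqrt C * (((K + 1 : ℕ) : ℝ) ^ (-(a / 2))) := by
        rw [Real.sqrt_mul hC, Real.sqrt_sq (Real.rpow_nonneg hKpos.le _)]

/-- [folklore] EXPONENT 1 (`window-key-core`'s booked-mass letter (AC)): if `0 ≤ w K ≤ C·e^{−a·log K}` for `K ≥ 1` with `a > 1`, then `Σ_K w K < ∞`
(`e^{−a log K} = K^{−a}`, `Real.summable_nat_rpow`). -/
theorem summable_of_le_exp_log {C a : ℝ} (ha : 1 < a) (w : ℕ → ℝ) (hw0 : ∀ K, 0 ≤ w K)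
    (hw : ∀ K : ℕ, 1 ≤ K → w K ≤ C * Real.exp (-(a * Real.log K))) :
    Summable w := by
  have hs : Summable (fun K : ℕ => C * ((K : ℝ) ^ (-a))) := (Real.summable_nat_rpow.2 (by linarith)).mul_left _
  have hs1 : Summable (fun K : ℕ => C * (((K + 1 : ℕ) : ℝ) ^ (-a))) := (summable_nat_add_iff 1).2 hs
  refine (summable_nat_add_iff 1).1 (Summable.of_nonneg_of_le (fun K => hw0 _) (fun K => ?_) hs1)
  show w (K + 1) ≤ C * (((K + 1 : ℕ) : ℝ) ^ (-a))
  have hKpos : (0 : ℝ) < ((K + 1 : ℕ) : ℝ) := by positivity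
  have e : Real.exp (-(a * Real.log ((K + 1 : ℕ) : ℝ))) = ((K + 1 : ℕ) : ℝ) ^ (-a) := by
    rw [Real.rpow_def_of_pos hKpos]; congr 1; ring
  calc w (K + 1) ≤ C * Real.exp (-(a * Real.log ((K + 1 : ℕ) : ℝ))) := hw (K + 1) (Nat.succ_le_succ (Nat.zero_le K))
    _ = C * (((K + 1 : ℕ) : ℝ) ^ (-a)) := by rw [e]

end Rates

/-! ## §4 ASSEMBLY: the over-aged one-run mass from the refresh-process letters -/

section Assembly

/-- **★★ ONE `(K,t)`, RATE FORM** [folklore].  Letters, per birth depth `m`: event sets `U m`, factors `0 ≤ w m j ≤ e^{−P m j}`, the rate `θ ≥ 0` with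
`θ·ℓ m j ≤ P m j ∕ 2`, the entropy `Σ_{U m} e^{−P∕2} ≤ Z₀ + ζ·m`, a budget `b`, a block entropy `Λ` with `Λ + ζ < θ`, a threshold `x`, and the MODELLING letter
`hmodel`: the over-aged mass `wild` is at most `C₀` times ANY upper bound of the partial sums of `Σ_m 𝟙[x ≤ m]·e^{Λ m}·(pattern sum of depth `m` at over-age
`m − b`)`.  Conclusion: `wild ≤ C₀ · e^{Z₀ + θ b} · e^{−(θ−Λ−ζ)·x} ∕ (1 − e^{−(θ−Λ−ζ)})`.  (`hmodel` is where (KR), the positions `e^{Λm}` and the birth density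
live; it is a HYPOTHESIS produced by nobody.) -/
theorem wildMass_rate_of_refreshProcess (U : ℕ → Finset α) (w ℓ P : ℕ → α → ℝ)
    (hw0 : ∀ m, ∀ j ∈ U m, 0 ≤ w m j) (hw : ∀ m, ∀ j ∈ U m, w m j ≤ Real.exp (-P m j))
    {θ : ℝ} (hθ : 0 ≤ θ) (hθP : ∀ m, ∀ j ∈ U m, θ * ℓ m j ≤ P m j / 2)
    {Z₀ ζ : ℝ} (hZ : ∀ m : ℕ, ∑ j ∈ U m, Real.exp (-(P m j / 2)) ≤ Z₀ + ζ * m)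
    {Λ : ℝ} (hΛθ : Λ + ζ < θ) (b : ℝ) {wild C₀ : ℝ} (x : ℝ)
    (hmodel : ∀ s : ℝ, (∀ M : ℕ, ∑ m ∈ range M,
        (if x ≤ (m : ℝ) then Real.exp (Λ * m) *
          ∑ S ∈ (U m).powerset with ((m : ℝ) - b ≤ ∑ j ∈ S, ℓ m j), ∏ j ∈ S, w m j else 0) ≤ s) →
        wild ≤ C₀ * s) :
    wild ≤ C₀ * (Real.exp (Z₀ + θ * b) * (Real.exp (-((θ - Λ - ζ) * x)) / (1 - Real.exp (-(θ - Λ - ζ))))) := by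
  set r : ℝ := θ - Λ - ζ with hr
  have hr0 : 0 < r := by rw [hr]; linarith
  apply hmodel
  intro M
  have hterm : ∀ m : ℕ,
      (if x ≤ (m : ℝ) then Real.exp (Λ * m) *
          ∑ S ∈ (U m).powerset with ((m : ℝ) - b ≤ ∑ j ∈ S, ℓ m j), ∏ j ∈ S, w m j else 0)
        ≤ Real.exp (Z₀ + θ * b) * (if x ≤ (m : ℝ) then Real.exp (-(r * m)) else 0) := by
    intro m
    by_cases hxm : x ≤ (m : ℝ)
    · rw [if_pos hxm, if_pos hxm]
      have hpm := patternSum_le_of_priceLetters (U m) (hw0 m) (hw m) hθ (hθP m) (hZ m) ((m : ℝ) - b)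
      calc Real.exp (Λ * m) * ∑ S ∈ (U m).powerset with ((m : ℝ) - b ≤ ∑ j ∈ S, ℓ m j), ∏ j ∈ S, w m j
          ≤ Real.exp (Λ * m) * (Real.exp (-(θ * ((m : ℝ) - b))) * Real.exp (Z₀ + ζ * m)) :=
            mul_le_mul_of_nonneg_left hpm (Real.exp_nonneg _)
        _ = Real.exp (Z₀ + θ * b) * Real.exp (-(r * m)) := by
            rw [← Real.exp_add, ← Real.exp_add, ← Real.exp_add]; congr 1; rw [hr]; ring
    · rw [if_neg hxm, if_neg hxm, mul_zero]
  calc ∑ m ∈ range M, (if x ≤ (m : ℝ) then Real.exp (Λ * m) *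
          ∑ S ∈ (U m).powerset with ((m : ℝ) - b ≤ ∑ j ∈ S, ℓ m j), ∏ j ∈ S, w m j else 0)
      ≤ ∑ m ∈ range M, Real.exp (Z₀ + θ * b) * (if x ≤ (m : ℝ) then Real.exp (-(r * m)) else 0) :=
        sum_le_sum fun m _ => hterm m
    _ = Real.exp (Z₀ + θ * b) * ∑ m ∈ range M, (if x ≤ (m : ℝ) then Real.exp (-(r * m)) else 0) := by
        rw [mul_sum]
    _ ≤ Real.exp (Z₀ + θ * b) * (Real.exp (-(r * x)) / (1 - Real.exp (-r))) :=
        mul_le_mul_of_nonneg_left (sum_indicator_exp_le hr0 x M) (Real.exp_nonneg _)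

/-- **★★ ALONG `K`, RATE FORM** [folklore].  Per `(K, t, m)`: event sets `U`, factors `0 ≤ w ≤ e^{−P}`, epoch lengths `ℓ`, with the UNIFORM rate `θ ≥ 0`
(`θ·ℓ ≤ P∕2`), entropy `Z₀ + ζ m`, budget `b`, block entropy `Λ` (`Λ + ζ < θ`), and the MODELLING letter at the threshold `x_K = b + κ₁·log K` (the window's age
margin) for every `K ≥ 1`.  Then for all `K ≥ 1`, `|t| ≤ l₀`: `wild K t ≤ C·e^{−κ₁(θ−Λ−ζ)·log K}` with `C = C₀·e^{Z₀+θb}·e^{−(θ−Λ−ζ)b}∕(1 − e^{−(θ−Λ−ζ)})` —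
the rate `K^{−κ₁(θ−Λ−ζ)}` of the memo's §3(e), for either exponent. -/
theorem wildMass_rateAlongK_of_refreshProcess {l₀ : ℝ} (wild : ℕ → ℝ → ℝ)
    {θ Λ ζ κ₁ Z₀ C₀ : ℝ} (b : ℝ) (hθ : 0 ≤ θ) (hΛθ : Λ + ζ < θ)
    (U : ℕ → ℝ → ℕ → Finset α) (w ℓ P : ℕ → ℝ → ℕ → α → ℝ)
    (hw0 : ∀ K t m, ∀ j ∈ U K t m, 0 ≤ w K t m j)
    (hw : ∀ K t m, ∀ j ∈ U K t m, w K t m j ≤ Real.exp (-P K t m j))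
    (hθP : ∀ K t m, ∀ j ∈ U K t m, θ * ℓ K t m j ≤ P K t m j / 2)
    (hZ : ∀ K t (m : ℕ), ∑ j ∈ U K t m, Real.exp (-(P K t m j / 2)) ≤ Z₀ + ζ * m)
    (hmodel : ∀ (K : ℕ) (t : ℝ), |t| ≤ l₀ → 1 ≤ K → ∀ s : ℝ,
      (∀ M : ℕ, ∑ m ∈ range M, (if b + κ₁ * Real.log (K : ℝ) ≤ (m : ℝ) then
          Real.exp (Λ * m) * ∑ S ∈ (U K t m).powerset with ((m : ℝ) - b ≤ ∑ j ∈ S, ℓ K t m j), ∏ j ∈ S, w K t m j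
        else 0) ≤ s) →
      wild K t ≤ C₀ * s) :
    ∀ (K : ℕ) (t : ℝ), |t| ≤ l₀ → 1 ≤ K →
      wild K t ≤ C₀ * (Real.exp (Z₀ + θ * b) * (Real.exp (-((θ - Λ - ζ) * b)) / (1 - Real.exp (-(θ - Λ - ζ)))))
        * Real.exp (-(κ₁ * (θ - Λ - ζ) * Real.log K)) := by
  intro K t ht hK1
  have hrate := wildMass_rate_of_refreshProcess (U K t) (w K t) (ℓ K t) (P K t) (hw0 K t) (hw K t) hθ (hθP K t)
    (hZ K t) hΛθ b (b + κ₁ * Real.log (K : ℝ)) (hmodel K t ht hK1)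
  have e : Real.exp (-((θ - Λ - ζ) * (b + κ₁ * Real.log (K : ℝ))))
      = Real.exp (-((θ - Λ - ζ) * b)) * Real.exp (-(κ₁ * (θ - Λ - ζ) * Real.log (K : ℝ))) := by
    rw [← Real.exp_add]; congr 1; ring
  rw [e] at hrate
  calc wild K t ≤ C₀ * (Real.exp (Z₀ + θ * b) * (Real.exp (-((θ - Λ - ζ) * b)) * Real.exp (-(κ₁ * (θ - Λ - ζ) * Real.log K))
        / (1 - Real.exp (-(θ - Λ - ζ))))) := hrate
    _ = _ := by ring

/-- **★★★ ALL `K`, `|t| ≤ l₀` — THE (V‑a) BINDER LIST OF `hellingerRate_of_tameTilts` FROM THE REFRESH-PROCESS LETTERS** [folklore].  The letters of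
`wildMass_rateAlongK_of_refreshProcess` with `C₀ ≥ 0`, the a-priori bound `wild K t ≤ 1` on the window (a sub-probability mass; it serves `K = 0`), and
`κ₁·(θ − Λ − ζ) > 2` ⇒ `∃ wm ≥ 0` with `Summable (√wm)` and `wild K t ≤ wm K` for all `K` and `|t| ≤ l₀` (`wm K = C·e^{−κ₁(θ−Λ−ζ)·log K} (+ 1 at K = 0)`). -/
theorem wildMass_summable_of_refreshProcess {l₀ : ℝ} (wild : ℕ → ℝ → ℝ)
    (hwild1 : ∀ K t, |t| ≤ l₀ → wild K t ≤ 1)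
    {θ Λ ζ κ₁ Z₀ C₀ : ℝ} (b : ℝ) (hθ : 0 ≤ θ) (hΛθ : Λ + ζ < θ) (hκ : 2 < κ₁ * (θ - Λ - ζ)) (hC₀ : 0 ≤ C₀)
    (U : ℕ → ℝ → ℕ → Finset α) (w ℓ P : ℕ → ℝ → ℕ → α → ℝ)
    (hw0 : ∀ K t m, ∀ j ∈ U K t m, 0 ≤ w K t m j)
    (hw : ∀ K t m, ∀ j ∈ U K t m, w K t m j ≤ Real.exp (-P K t m j))
    (hθP : ∀ K t m, ∀ j ∈ U K t m, θ * ℓ K t m j ≤ P K t m j / 2)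
    (hZ : ∀ K t (m : ℕ), ∑ j ∈ U K t m, Real.exp (-(P K t m j / 2)) ≤ Z₀ + ζ * m)
    (hmodel : ∀ (K : ℕ) (t : ℝ), |t| ≤ l₀ → 1 ≤ K → ∀ s : ℝ,
      (∀ M : ℕ, ∑ m ∈ range M, (if b + κ₁ * Real.log (K : ℝ) ≤ (m : ℝ) then
          Real.exp (Λ * m) * ∑ S ∈ (U K t m).powerset with ((m : ℝ) - b ≤ ∑ j ∈ S, ℓ K t m j), ∏ j ∈ S, w K t m j
        else 0) ≤ s) →
      wild K t ≤ C₀ * s) :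
    ∃ wm : ℕ → ℝ, (∀ K, 0 ≤ wm K) ∧ Summable (fun K => Real.sqrt (wm K)) ∧
      ∀ K t, |t| ≤ l₀ → wild K t ≤ wm K := by
  have hrate := wildMass_rateAlongK_of_refreshProcess wild b hθ hΛθ U w ℓ P hw0 hw hθP hZ hmodel
  have h1r : 0 < 1 - Real.exp (-(θ - Λ - ζ)) := sub_pos.2 (Real.exp_lt_one_iff.2 (by linarith))
  set C : ℝ := C₀ * (Real.exp (Z₀ + θ * b) * (Real.exp (-((θ - Λ - ζ) * b)) / (1 - Real.exp (-(θ - Λ - ζ))))) with hC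
  have hC0 : 0 ≤ C := mul_nonneg hC₀ (mul_nonneg (Real.exp_nonneg _) (div_nonneg (Real.exp_nonneg _) h1r.le))
  refine ⟨fun K => C * Real.exp (-(κ₁ * (θ - Λ - ζ) * Real.log K)) + (if K = 0 then 1 else 0), fun K => ?_, ?_, fun K t ht => ?_⟩
  · have : 0 ≤ (if K = 0 then (1:ℝ) else 0) := by split_ifs <;> norm_num
    exact add_nonneg (mul_nonneg hC0 (Real.exp_nonneg _)) this
  · refine summable_sqrt_of_le_exp_log hC0 hκ _ (fun K hK => ?_)
    rw [if_neg (by omega), add_zero]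
  · dsimp only
    by_cases hK : K = 0
    · subst hK
      rw [if_pos rfl]
      have := hwild1 0 t ht
      have : 0 ≤ C * Real.exp (-(κ₁ * (θ - Λ - ζ) * Real.log ((0:ℕ):ℝ))) := mul_nonneg hC0 (Real.exp_nonneg _)
      linarith
    · rw [if_neg hK, add_zero]
      exact hrate K t ht (Nat.one_le_iff_ne_zero.2 hK)

/-- [folklore] THE EXPONENT-1 EDITION (the booked-mass letter (AC) of `window-key-core`): the same letters with only `κ₁·(θ − Λ − ζ) > 1` give `∃ wm ≥ 0` with
`Summable wm` and `wild K t ≤ wm K` for all `K`, `|t| ≤ l₀`. -/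
theorem wildMass_summableOne_of_refreshProcess {l₀ : ℝ} (wild : ℕ → ℝ → ℝ)
    (hwild1 : ∀ K t, |t| ≤ l₀ → wild K t ≤ 1)
    {θ Λ ζ κ₁ Z₀ C₀ : ℝ} (b : ℝ) (hθ : 0 ≤ θ) (hΛθ : Λ + ζ < θ) (hκ : 1 < κ₁ * (θ - Λ - ζ)) (hC₀ : 0 ≤ C₀)
    (U : ℕ → ℝ → ℕ → Finset α) (w ℓ P : ℕ → ℝ → ℕ → α → ℝ)
    (hw0 : ∀ K t m, ∀ j ∈ U K t m, 0 ≤ w K t m j)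
    (hw : ∀ K t m, ∀ j ∈ U K t m, w K t m j ≤ Real.exp (-P K t m j))
    (hθP : ∀ K t m, ∀ j ∈ U K t m, θ * ℓ K t m j ≤ P K t m j / 2)
    (hZ : ∀ K t (m : ℕ), ∑ j ∈ U K t m, Real.exp (-(P K t m j / 2)) ≤ Z₀ + ζ * m)
    (hmodel : ∀ (K : ℕ) (t : ℝ), |t| ≤ l₀ → 1 ≤ K → ∀ s : ℝ,
      (∀ M : ℕ, ∑ m ∈ range M, (if b + κ₁ * Real.log (K : ℝ) ≤ (m : ℝ) then
          Real.exp (Λ * m) * ∑ S ∈ (U K t m).powerset with ((m : ℝ) - b ≤ ∑ j ∈ S, ℓ K t m j), ∏ j ∈ S, w K t m j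
        else 0) ≤ s) →
      wild K t ≤ C₀ * s) :
    ∃ wm : ℕ → ℝ, (∀ K, 0 ≤ wm K) ∧ Summable wm ∧ ∀ K t, |t| ≤ l₀ → wild K t ≤ wm K := by
  have hrate := wildMass_rateAlongK_of_refreshProcess wild b hθ hΛθ U w ℓ P hw0 hw hθP hZ hmodel
  have h1r : 0 < 1 - Real.exp (-(θ - Λ - ζ)) := sub_pos.2 (Real.exp_lt_one_iff.2 (by linarith))
  set C : ℝ := C₀ * (Real.exp (Z₀ + θ * b) * (Real.exp (-((θ - Λ - ζ) * b)) / (1 - Real.exp (-(θ - Λ - ζ))))) with hC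
  have hC0 : 0 ≤ C := mul_nonneg hC₀ (mul_nonneg (Real.exp_nonneg _) (div_nonneg (Real.exp_nonneg _) h1r.le))
  have hhead : Summable fun K : ℕ => (if K = 0 then (1:ℝ) else 0) := by
    refine summable_of_ne_finset_zero (s := {0}) fun K hK => ?_
    rw [mem_singleton] at hK
    simp [hK]
  refine ⟨fun K => C * Real.exp (-(κ₁ * (θ - Λ - ζ) * Real.log K)) + (if K = 0 then 1 else 0), fun K => ?_, ?_, fun K t ht => ?_⟩
  · have : 0 ≤ (if K = 0 then (1:ℝ) else 0) := by split_ifs <;> norm_num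
    exact add_nonneg (mul_nonneg hC0 (Real.exp_nonneg _)) this
  · refine Summable.add ?_ hhead
    exact summable_of_le_exp_log (C := C) hκ _ (fun K => mul_nonneg hC0 (Real.exp_nonneg _)) fun K _ => le_rfl
  · dsimp only
    by_cases hK : K = 0
    · subst hK
      rw [if_pos rfl]
      have := hwild1 0 t ht
      have : 0 ≤ C * Real.exp (-(κ₁ * (θ - Λ - ζ) * Real.log ((0:ℕ):ℝ))) := mul_nonneg hC0 (Real.exp_nonneg _)
      linarith
    · rw [if_neg hK, add_zero]
      exact hrate K t ht (Nat.one_le_iff_ne_zero.2 hK)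

/-- [folklore] TWO RUNS SHARE ONE `wm` (the consumer's `hwildA`, `hwildB` name a single `wm`): two √-summable certificates merge by `wm := wmA + wmB`
(`√(a + b) ≤ √a + √b`). -/
theorem wildMass_summable_pair {l₀ : ℝ} {wildA wildB : ℕ → ℝ → ℝ}
    (hA : ∃ wm : ℕ → ℝ, (∀ K, 0 ≤ wm K) ∧ Summable (fun K => Real.sqrt (wm K)) ∧ ∀ K t, |t| ≤ l₀ → wildA K t ≤ wm K)
    (hB : ∃ wm : ℕ → ℝ, (∀ K, 0 ≤ wm K) ∧ Summable (fun K => Real.sqrt (wm K)) ∧ ∀ K t, |t| ≤ l₀ → wildB K t ≤ wm K) :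
    ∃ wm : ℕ → ℝ, (∀ K, 0 ≤ wm K) ∧ Summable (fun K => Real.sqrt (wm K)) ∧
      (∀ K t, |t| ≤ l₀ → wildA K t ≤ wm K) ∧ (∀ K t, |t| ≤ l₀ → wildB K t ≤ wm K) := by
  obtain ⟨wa, ha0, has, haw⟩ := hA
  obtain ⟨wb, hb0, hbs, hbw⟩ := hB
  refine ⟨fun K => wa K + wb K, fun K => add_nonneg (ha0 K) (hb0 K), ?_,
    fun K t ht => by linarith [haw K t ht, hb0 K], fun K t ht => by linarith [hbw K t ht, ha0 K]⟩
  refine Summable.of_nonneg_of_le (fun K => Real.sqrt_nonneg _) (fun K => ?_) (has.add hbs)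
  show Real.sqrt (wa K + wb K) ≤ Real.sqrt (wa K) + Real.sqrt (wb K)
  rw [Real.sqrt_le_iff]
  refine ⟨add_nonneg (Real.sqrt_nonneg _) (Real.sqrt_nonneg _), ?_⟩
  nlinarith [Real.sq_sqrt (ha0 K), Real.sq_sqrt (hb0 K), Real.sqrt_nonneg (wa K), Real.sqrt_nonneg (wb K),
    mul_nonneg (Real.sqrt_nonneg (wa K)) (Real.sqrt_nonneg (wb K))]

end Assembly

end Summit.QuantumFields.YangMills.BalabanUVNodes.N20OverAgeRefreshProcess

end
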